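import Mathlib
import HarnessLib
import Summits.NavierStokesRegularity.NavierStokesRegularity.Theses.IsobarTomography

/-!
# Crux-triage r1/k3 evidence — `TubeAlternative` (stmt-NavierStokesRegularity-11739)

Card `peak-pit-dichotomy`: its typed companion statement `PeakPitAlternative`
(`Cruxes/TubeAlternative/SketchIdeator1.lean`, copied VERBATIM below as the Cruxes module is not
part of the farm build) is, for each `θ`, a disjunction `(A θ) ∨ (B θ ν T u p)` whose first
disjunct — the "degenerate-pit limit" the card's pit-centred zoom is meant to PRODUCE — does not
mention the blowing-up solution `u` at all.  Recorded here (sorry-free):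

* `peakPitAlternative_iff` — the statement is equivalent to
  `∀ θ ∈ (0,1), (A θ) ∨ (∀ antecedent instances, B θ …)`: for each `θ`, either a FIXED object
  exists, or EVERY Type-I blob-failing solution has `θ`-separation of all `θ`-near-maximal
  vorticity points from all positive-semidefinite pressure-critical points, cofinally in time.
* `antiLiouville_of_branchA` — `(A θ)` alone yields a KNSS blow-up limit (tree sense) with a
  classical pressure on `(-∞,0)` that is NOT slice-wise constant, i.e. a counterexample to the
  KNSS Liouville statement in the classical-pressure class (the pattern of p101533
  `antiLiouville_of_localSelection`): the produced branch is Liouville-hard to exhibit and carries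
  no information about `u`.
-/

set_option linter.dupNamespace false

noncomputable section

namespace Summit.NavierStokesRegularity.NavierStokesRegularity.Cruxes.TubeAlternative.TriageK3

open Set Filter Topology Function
open Literature.Analysis.FluidPDE

local notation "E3" => EuclideanSpace ℝ (Fin 3)

/-! ## Verbatim copy of `PeakPitAlternative` (SketchIdeator1.lean l.296–314) -/

/-- (copy) `PeakPitAlternative` — card `peak-pit-dichotomy`'s degenerate-pit / separation split. -/
def PeakPitAlternative : Prop :=
  ∀ (ν T : ℝ), 0 < ν → 0 < T → ∀ (u : ℝ → E3 → E3) (p : ℝ → E3 → ℝ),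
    IsMaximalSmoothSolution ν 0 u p T → IsLerayHopfOn T ν 0 (u 0) u →
    HasRapidSpatialDecay (u 0) → IsTypeIBlowup u T →
    (¬ ∃ κ : ℝ, 0 < κ ∧ ∃ Ω : ℝ → ℝ, ∃ t₀ ∈ Set.Ico 0 T, ∀ t ∈ Set.Ico t₀ T,
      (∃ x : E3, Ω t < ‖curl (u t) x‖) ∧ ∀ x : E3, Ω t < ‖curl (u t) x‖ →
        κ * ‖curl (u t) x‖ ^ 2 * Laplacian.laplacian (p t) x ≤
          iteratedFDeriv ℝ 2 (p t) x ![curl (u t) x, curl (u t) x]) →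
    ∀ θ : ℝ, 0 < θ → θ < 1 →
    (∃ (v : ℝ → E3 → E3) (q : ℝ → E3 → ℝ) (a : ℝ), 0 < a ∧ IsKNSSBlowupLimit v ∧
      IsClassicalNSSolutionOn (Set.Iio a) 1 0 v q ∧
      ∃ t₀ : ℝ, t₀ < 0 ∧ ∃ x₀ : E3, gradient (q t₀) x₀ = 0 ∧
        (∀ e : E3, 0 ≤ iteratedFDeriv ℝ 2 (q t₀) x₀ ![e, e]) ∧
        0 < ‖curl (v t₀) x₀‖ ∧ (∀ x : E3, θ * ‖curl (v t₀) x‖ ≤ ‖curl (v t₀) x₀‖) ∧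
        iteratedFDeriv ℝ 2 (q t₀) x₀ ![curl (v t₀) x₀, curl (v t₀) x₀] = 0) ∨
    (∃ d₀ : ℝ, 0 < d₀ ∧ ∀ t₁ ∈ Set.Ico 0 T, ∃ t ∈ Set.Ico t₁ T, ∀ x : E3,
      0 < ‖curl (u t) x‖ → (∀ y : E3, θ * ‖curl (u t) y‖ ≤ ‖curl (u t) x‖) →
      ∀ y : E3, gradient (p t) y = 0 → (∀ e : E3, 0 ≤ iteratedFDeriv ℝ 2 (p t) y ![e, e]) →
        d₀ * Real.sqrt (ν / ‖curl (u t) x‖) ≤ dist x y)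

/-! ## The two branches, named -/

/-- Branch (A) of `PeakPitAlternative` — the "degenerate-pit limit".  NOTE: no `u`, `p`, `ν`, `T`. -/
def BranchA (θ : ℝ) : Prop :=
  ∃ (v : ℝ → E3 → E3) (q : ℝ → E3 → ℝ) (a : ℝ), 0 < a ∧ IsKNSSBlowupLimit v ∧
    IsClassicalNSSolutionOn (Set.Iio a) 1 0 v q ∧
    ∃ t₀ : ℝ, t₀ < 0 ∧ ∃ x₀ : E3, gradient (q t₀) x₀ = 0 ∧
      (∀ e : E3, 0 ≤ iteratedFDeriv ℝ 2 (q t₀) x₀ ![e, e]) ∧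
      0 < ‖curl (v t₀) x₀‖ ∧ (∀ x : E3, θ * ‖curl (v t₀) x‖ ≤ ‖curl (v t₀) x₀‖) ∧
      iteratedFDeriv ℝ 2 (q t₀) x₀ ![curl (v t₀) x₀, curl (v t₀) x₀] = 0

/-- Branch (B) of `PeakPitAlternative` — cofinal `θ`-separation of near-max vorticity points from
positive-semidefinite pressure-critical points. -/
def BranchB (θ ν T : ℝ) (u : ℝ → E3 → E3) (p : ℝ → E3 → ℝ) : Prop :=
  ∃ d₀ : ℝ, 0 < d₀ ∧ ∀ t₁ ∈ Set.Ico 0 T, ∃ t ∈ Set.Ico t₁ T, ∀ x : E3,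
    0 < ‖curl (u t) x‖ → (∀ y : E3, θ * ‖curl (u t) y‖ ≤ ‖curl (u t) x‖) →
    ∀ y : E3, gradient (p t) y = 0 → (∀ e : E3, 0 ≤ iteratedFDeriv ℝ 2 (p t) y ![e, e]) →
      d₀ * Real.sqrt (ν / ‖curl (u t) x‖) ≤ dist x y

/-- The crux's antecedent packaged (verbatim hypotheses of `TubeAlternative`). -/
def Antecedent (ν T : ℝ) (u : ℝ → E3 → E3) (p : ℝ → E3 → ℝ) : Prop :=
  0 < ν ∧ 0 < T ∧ IsMaximalSmoothSolution ν 0 u p T ∧ IsLerayHopfOn T ν 0 (u 0) u ∧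
    HasRapidSpatialDecay (u 0) ∧ IsTypeIBlowup u T ∧
    ¬ ∃ κ : ℝ, 0 < κ ∧ ∃ Ω : ℝ → ℝ, ∃ t₀ ∈ Set.Ico 0 T, ∀ t ∈ Set.Ico t₀ T,
      (∃ x : E3, Ω t < ‖curl (u t) x‖) ∧ ∀ x : E3, Ω t < ‖curl (u t) x‖ →
        κ * ‖curl (u t) x‖ ^ 2 * Laplacian.laplacian (p t) x ≤
          iteratedFDeriv ℝ 2 (p t) x ![curl (u t) x, curl (u t) x]

/-- Sanity: the verbatim statement is literally `antecedent → ∀ θ, A θ ∨ B θ …`. -/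
theorem peakPitAlternative_def :
    PeakPitAlternative ↔ ∀ (ν T : ℝ), 0 < ν → 0 < T → ∀ (u : ℝ → E3 → E3) (p : ℝ → E3 → ℝ),
      IsMaximalSmoothSolution ν 0 u p T → IsLerayHopfOn T ν 0 (u 0) u →
      HasRapidSpatialDecay (u 0) → IsTypeIBlowup u T →
      (¬ ∃ κ : ℝ, 0 < κ ∧ ∃ Ω : ℝ → ℝ, ∃ t₀ ∈ Set.Ico 0 T, ∀ t ∈ Set.Ico t₀ T,
        (∃ x : E3, Ω t < ‖curl (u t) x‖) ∧ ∀ x : E3, Ω t < ‖curl (u t) x‖ →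
          κ * ‖curl (u t) x‖ ^ 2 * Laplacian.laplacian (p t) x ≤
            iteratedFDeriv ℝ 2 (p t) x ![curl (u t) x, curl (u t) x]) →
      ∀ θ : ℝ, 0 < θ → θ < 1 → BranchA θ ∨ BranchB θ ν T u p :=
  Iff.rfl

/-- **The first branch is `u`-free, so the alternative splits per `θ` into "a fixed object exists"
or "every antecedent instance separates".** -/
theorem peakPitAlternative_iff :
    PeakPitAlternative ↔ ∀ θ : ℝ, 0 < θ → θ < 1 →
      (BranchA θ ∨ ∀ (ν T : ℝ) (u : ℝ → E3 → E3) (p : ℝ → E3 → ℝ),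
        Antecedent ν T u p → BranchB θ ν T u p) := by
  rw [peakPitAlternative_def]
  constructor
  · intro h θ hθ hθ1
    by_cases hA : BranchA θ
    · exact Or.inl hA
    · refine Or.inr fun ν T u p hant => ?_
      obtain ⟨hν, hT, hmax, hLH, hdec, hI, hnb⟩ := hant
      exact (h ν T hν hT u p hmax hLH hdec hI hnb θ hθ hθ1).resolve_left hA
  · intro h ν T hν hT u p hmax hLH hdec hI hnb θ hθ hθ1
    rcases h θ hθ hθ1 with hA | hB
    · exact Or.inl hA
    · exact Or.inr (hB ν T u p ⟨hν, hT, hmax, hLH, hdec, hI, hnb⟩)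

/-- **In particular, if branch (A) happens to hold for every `θ`, the whole statement holds with no
input from the antecedent** (it is then not a statement about Type-I blow-up at all). -/
theorem peakPitAlternative_of_branchA (hA : ∀ θ : ℝ, 0 < θ → θ < 1 → BranchA θ) :
    PeakPitAlternative :=
  peakPitAlternative_iff.2 fun θ hθ hθ1 => Or.inl (hA θ hθ hθ1)

/-- **Branch (A) is anti-Liouville.** A witness of `(A θ)` is a KNSS blow-up limit (tree sense)
with a classical pressure on `(-∞, 0)` which is not slice-wise constant (its slice at `t₀` has a
point of non-zero vorticity); so exhibiting branch (A) — for any single `θ` — refutes the KNSS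
Liouville statement in the classical-pressure class, exactly like the dead line's stub L3
(p101533 `antiLiouville_of_localSelection`). -/
theorem antiLiouville_of_branchA {θ : ℝ} (h : BranchA θ) :
    ∃ (v : ℝ → E3 → E3) (q : ℝ → E3 → ℝ), IsKNSSBlowupLimit v ∧
      IsClassicalNSSolutionOn (Set.Iio 0) 1 0 v q ∧ ¬ (∀ t < 0, ∃ b : E3, v t = fun _ => b) := by
  obtain ⟨v, q, a, ha, hv, hcl, t₀, ht₀, x₀, -, -, hpos, -, -⟩ := h
  refine ⟨v, q, hv, hcl.mono (Set.Iio_subset_Iio ha.le) isOpen_Iio.uniqueDiffOn, ?_⟩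
  intro hconst
  obtain ⟨b, hb⟩ := hconst t₀ ht₀
  have hc : curl (v t₀) x₀ = 0 := by
    rw [hb]; simp [curl]
  rw [hc, norm_zero] at hpos
  exact lt_irrefl _ hpos

/-- **… and conversely, whenever separation (B) fails for ONE antecedent instance at ONE `θ`,
the statement asserts the anti-Liouville object.** -/
theorem antiLiouville_of_peakPitAlternative_of_not_branchB (h : PeakPitAlternative)
    {θ ν T : ℝ} {u : ℝ → E3 → E3} {p : ℝ → E3 → ℝ} (hθ : 0 < θ) (hθ1 : θ < 1)
    (hant : Antecedent ν T u p) (hB : ¬ BranchB θ ν T u p) :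
    ∃ (v : ℝ → E3 → E3) (q : ℝ → E3 → ℝ), IsKNSSBlowupLimit v ∧
      IsClassicalNSSolutionOn (Set.Iio 0) 1 0 v q ∧ ¬ (∀ t < 0, ∃ b : E3, v t = fun _ => b) := by
  rcases peakPitAlternative_iff.1 h θ hθ hθ1 with hA | hall
  · exact antiLiouville_of_branchA hA
  · exact absurd (hall ν T u p hant) hB

end Summit.NavierStokesRegularity.NavierStokesRegularity.Cruxes.TubeAlternative.TriageK3

end
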